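import Summits.ResolutionOfSingularities.ResolutionOfSingularities.Theorems.WildPurityWildSymbolBirthDefs
import HarnessLib

/-!
# Route `WildPurity`, crux `WildSymbol` (stmt-ResolutionOfSingularities-17133), line `birth`:
# stub `stub_periodicTransport` — transport of non-integrality down a periodic tower

In Kato's symbolic `H³_p(K) = G K ⧸ N p K` let `Unr T` be the subgroup generated by the `T`-integral
symbols. A ring automorphism `σ : K ≃+* K` acts on generators by `tripleMap σ`, preserves the relation
subgroup `N p K` (each of the seven relation shapes is mapped to a relation of the same shape), hence
induces an endomorphism `Φ_σ` of `G ⧸ N` with two-sided inverse `Φ_{σ⁻¹}`, and `Φ_τ (Unr T) ⊆ Unr T'`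
whenever `τ T ⊆ T'`.

**Transport.** Let `(σ, O, S, α)` be a periodic tower: (i) `σ⁻¹ S ⊆ S`, (ii) every `x ∈ O` is
`σⁿ y` for some `y ∈ S`, (iii) `α` is `σ`-invariant. If `α ∈ Unr O`, then `α` is a `ℤ`-combination of
finitely many `O`-integral symbols; each entry `x` of each of them satisfies `σ⁻ᵐ x ∈ S` for all large
`m` (by (ii), and (i) makes the levels increase), so for `m` large `Φ_{σ⁻¹}^m α ∈ Unr S`; but
`Φ_{σ⁻¹} α = α` by (iii), so `α ∈ Unr S`. Contrapositive: `α ∉ Unr S → α ∉ Unr O`. Nothing uses that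
`p` is prime or that `O` is a valuation ring.

[folklore]
-/

noncomputable section

set_option linter.dupNamespace false -- mandated doubled namespace of this single-conjunct summit

namespace Summit.ResolutionOfSingularities.ResolutionOfSingularities.Theorems.WildSymbol.Birth

variable {K : Type} [Field K]

/-! ## Functoriality of `G ⧸ N` under ring automorphisms -/

/-- `tripleMap σ⁻¹ ∘ tripleMap σ = id` on generators. [folklore] -/
theorem tripleMap_symm_apply (σ : K ≃+* K) (t : K × Kˣ × Kˣ) :
    tripleMap σ.symm (tripleMap σ t) = t := by
  obtain ⟨a, b, c⟩ := t
  simp only [tripleMap, RingEquiv.symm_apply_apply, Prod.mk.injEq, true_and]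
  constructor <;> ext <;> simp

/-- `map (tripleMap σ⁻¹) ∘ map (tripleMap σ) = id` on `G K`. [folklore] -/
theorem map_symm_map_apply (σ : K ≃+* K) (x : G K) :
    FreeAbelianGroup.map (tripleMap σ.symm) (FreeAbelianGroup.map (tripleMap σ) x) = x := by
  rw [← FreeAbelianGroup.map_comp_apply]
  have h : tripleMap σ.symm ∘ tripleMap σ = id := funext (tripleMap_symm_apply σ)
  rw [h, FreeAbelianGroup.map_id_apply]

/-- A ring automorphism preserves Kato's relation subgroup: each of the seven relation shapes is mapped
to a relation of the same shape. [folklore] -/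
theorem N_le_comap (p : ℕ) (τ : K ≃+* K) :
    N p K ≤ (N p K).comap (FreeAbelianGroup.map (tripleMap τ)) := by
  refine (AddSubgroup.closure_le _).2 ?_
  intro x hx
  rw [SetLike.mem_coe, AddSubgroup.mem_comap]
  refine AddSubgroup.subset_closure ?_
  rcases hx with ⟨a, a', b, c, rfl⟩ | ⟨a, b, b', c, rfl⟩ | ⟨a, b, c, c', rfl⟩ | ⟨a, b, rfl⟩ |
    ⟨b, c, rfl⟩ | ⟨b, c, rfl⟩ | ⟨a, b, c, rfl⟩
  · exact Or.inl ⟨τ a, τ a', Units.map (τ : K →* K) b, Units.map (τ : K →* K) c,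
      by simp [tripleMap]⟩
  · exact Or.inr <| Or.inl ⟨τ a, Units.map (τ : K →* K) b, Units.map (τ : K →* K) b',
      Units.map (τ : K →* K) c, by simp [tripleMap]⟩
  · exact Or.inr <| Or.inr <| Or.inl ⟨τ a, Units.map (τ : K →* K) b, Units.map (τ : K →* K) c,
      Units.map (τ : K →* K) c', by simp [tripleMap]⟩
  · exact Or.inr <| Or.inr <| Or.inr <| Or.inl ⟨τ a, Units.map (τ : K →* K) b, by simp [tripleMap]⟩
  · exact Or.inr <| Or.inr <| Or.inr <| Or.inr <| Or.inl
      ⟨Units.map (τ : K →* K) b, Units.map (τ : K →* K) c, by simp [tripleMap]⟩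
  · exact Or.inr <| Or.inr <| Or.inr <| Or.inr <| Or.inr <| Or.inl
      ⟨Units.map (τ : K →* K) b, Units.map (τ : K →* K) c, by simp [tripleMap]⟩
  · exact Or.inr <| Or.inr <| Or.inr <| Or.inr <| Or.inr <| Or.inr
      ⟨τ a, Units.map (τ : K →* K) b, Units.map (τ : K →* K) c, by simp [tripleMap]⟩

/-- The endomorphism of `G ⧸ N` induced by `σ⁻¹` is a left inverse of the one induced by `σ`.
[folklore] -/
theorem quotMap_symm_apply (p : ℕ) (σ : K ≃+* K) (β : G K ⧸ N p K) :
    QuotientAddGroup.map (N p K) (N p K) (FreeAbelianGroup.map (tripleMap σ.symm))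
        (N_le_comap p σ.symm)
      (QuotientAddGroup.map (N p K) (N p K) (FreeAbelianGroup.map (tripleMap σ)) (N_le_comap p σ)
        β) = β := by
  induction β using QuotientAddGroup.induction_on with
  | H g => rw [QuotientAddGroup.map_mk, QuotientAddGroup.map_mk, map_symm_map_apply]

/-- `Φ_τ (Unr T) ⊆ Unr T'` whenever `τ T ⊆ T'`: the image of a `T`-integral symbol is `T'`-integral.
[folklore] -/
theorem quotMap_mem_Unr (p : ℕ) (τ : K ≃+* K) {T T' : Subring K}
    (hT : ∀ x : K, x ∈ T → τ x ∈ T') {β : G K ⧸ N p K} (hβ : β ∈ Unr p K T) :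
    QuotientAddGroup.map (N p K) (N p K) (FreeAbelianGroup.map (tripleMap τ)) (N_le_comap p τ) β ∈
      Unr p K T' := by
  unfold Unr at hβ
  induction hβ using AddSubgroup.closure_induction with
  | mem y hy =>
    obtain ⟨a, b, c, ha, hb, hb', hc, hc', rfl⟩ := hy
    rw [QuotientAddGroup.map_mk, FreeAbelianGroup.map_of_apply]
    refine AddSubgroup.subset_closure
      ⟨τ a, Units.map (τ : K →* K) b, Units.map (τ : K →* K) c, hT _ ha, ?_, ?_, ?_, ?_, rfl⟩
    · rw [Units.coe_map, MonoidHom.coe_coe]; exact hT _ hb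
    · rw [Units.coe_map_inv, MonoidHom.coe_coe]; exact hT _ hb'
    · rw [Units.coe_map, MonoidHom.coe_coe]; exact hT _ hc
    · rw [Units.coe_map_inv, MonoidHom.coe_coe]; exact hT _ hc'
  | zero => rw [map_zero]; exact (Unr p K T').zero_mem
  | add x y _ _ hx hy => rw [map_add]; exact (Unr p K T').add_mem hx hy
  | neg x _ hx => rw [map_neg]; exact (Unr p K T').neg_mem hx

/-! ## The tower: levels in `K` and in `G ⧸ N` -/

/-- If `σ⁻¹ S ⊆ S`, the levels `{x | σ⁻ⁿ x ∈ S}` increase with `n`. [folklore] -/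
theorem iterate_symm_mem_of_le (σ : K ≃+* K) {S : Subring K}
    (h1 : ∀ x : K, x ∈ S → σ.symm x ∈ S) {x : K} {n : ℕ} (hx : σ.symm^[n] x ∈ S) {m : ℕ}
    (hm : n ≤ m) : σ.symm^[m] x ∈ S := by
  induction m, hm using Nat.le_induction with
  | base => exact hx
  | succ m _ ih => rw [Function.iterate_succ_apply']; exact h1 _ ih

/-- An element of the tower `⋃ₙ σⁿ S` has a level. [folklore] -/
theorem exists_iterate_symm_mem (σ : K ≃+* K) {S : Subring K} {x : K}
    (h : ∃ (n : ℕ) (y : K), y ∈ S ∧ x = σ^[n] y) : ∃ n : ℕ, σ.symm^[n] x ∈ S := by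
  obtain ⟨n, y, hy, rfl⟩ := h
  have hl : Function.LeftInverse σ.symm σ := σ.symm_apply_apply
  exact ⟨n, by rw [hl.iterate n y]; exact hy⟩

/-- A symbol all of whose entries have level `n` is sent into `Unr S` by `Φ_{σ⁻¹}^n`. [folklore] -/
theorem iterate_quotMap_mk_of_mem_Unr (p : ℕ) (σ : K ≃+* K) (S : Subring K) :
    ∀ (n : ℕ) (a : K) (b c : Kˣ), σ.symm^[n] a ∈ S → σ.symm^[n] (b : K) ∈ S →
      σ.symm^[n] ((b⁻¹ : Kˣ) : K) ∈ S → σ.symm^[n] (c : K) ∈ S →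
      σ.symm^[n] ((c⁻¹ : Kˣ) : K) ∈ S →
      (QuotientAddGroup.map (N p K) (N p K) (FreeAbelianGroup.map (tripleMap σ.symm))
        (N_le_comap p σ.symm))^[n] ((FreeAbelianGroup.of (a, b, c) : G K) : G K ⧸ N p K) ∈
        Unr p K S
  | 0, a, b, c, ha, hb, hb', hc, hc' =>
    AddSubgroup.subset_closure ⟨a, b, c, ha, hb, hb', hc, hc', rfl⟩
  | n + 1, a, b, c, ha, hb, hb', hc, hc' => by
    rw [Function.iterate_succ_apply, QuotientAddGroup.map_mk, FreeAbelianGroup.map_of_apply]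
    refine iterate_quotMap_mk_of_mem_Unr p σ S n (σ.symm a) (Units.map (σ.symm : K →* K) b)
      (Units.map (σ.symm : K →* K) c) ?_ ?_ ?_ ?_ ?_
    · rwa [Function.iterate_succ_apply] at ha
    · rw [Units.coe_map, MonoidHom.coe_coe, ← Function.iterate_succ_apply]; exact hb
    · rw [Units.coe_map_inv, MonoidHom.coe_coe, ← Function.iterate_succ_apply]; exact hb'
    · rw [Units.coe_map, MonoidHom.coe_coe, ← Function.iterate_succ_apply]; exact hc
    · rw [Units.coe_map_inv, MonoidHom.coe_coe, ← Function.iterate_succ_apply]; exact hc'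

/-- If `σ⁻¹ S ⊆ S`, the levels `{β | Φ_{σ⁻¹}^n β ∈ Unr S}` of `G ⧸ N` increase with `n`. [folklore] -/
theorem iterate_quotMap_mem_Unr_of_le (p : ℕ) (σ : K ≃+* K) {S : Subring K}
    (h1 : ∀ x : K, x ∈ S → σ.symm x ∈ S) {β : G K ⧸ N p K} {n : ℕ}
    (hβ : (QuotientAddGroup.map (N p K) (N p K) (FreeAbelianGroup.map (tripleMap σ.symm))
      (N_le_comap p σ.symm))^[n] β ∈ Unr p K S) {m : ℕ} (hm : n ≤ m) :
    (QuotientAddGroup.map (N p K) (N p K) (FreeAbelianGroup.map (tripleMap σ.symm))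
      (N_le_comap p σ.symm))^[m] β ∈ Unr p K S := by
  induction m, hm using Nat.le_induction with
  | base => exact hβ
  | succ m _ ih => rw [Function.iterate_succ_apply']; exact quotMap_mem_Unr p σ.symm h1 ih

/-- **Finite bookkeeping.** If `σ⁻¹ S ⊆ S` and `O` is exhausted by the tower `⋃ₙ σⁿ S`, every class of
`Unr O` is sent into `Unr S` by some power of `Φ_{σ⁻¹}`. [folklore] -/
theorem exists_iterate_quotMap_mem_Unr (p : ℕ) (σ : K ≃+* K) (O : ValuationSubring K)
    (S : Subring K) (h1 : ∀ x : K, x ∈ S → σ.symm x ∈ S)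
    (h2 : ∀ x : K, x ∈ O → ∃ (n : ℕ) (y : K), y ∈ S ∧ x = σ^[n] y) {β : G K ⧸ N p K}
    (hβ : β ∈ Unr p K O.toSubring) :
    ∃ n : ℕ, (QuotientAddGroup.map (N p K) (N p K) (FreeAbelianGroup.map (tripleMap σ.symm))
      (N_le_comap p σ.symm))^[n] β ∈ Unr p K S := by
  unfold Unr at hβ
  induction hβ using AddSubgroup.closure_induction with
  | mem y hy =>
    obtain ⟨a, b, c, ha, hb, hb', hc, hc', rfl⟩ := hy
    obtain ⟨n₁, hn₁⟩ := exists_iterate_symm_mem σ (h2 a ha)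
    obtain ⟨n₂, hn₂⟩ := exists_iterate_symm_mem σ (h2 _ hb)
    obtain ⟨n₃, hn₃⟩ := exists_iterate_symm_mem σ (h2 _ hb')
    obtain ⟨n₄, hn₄⟩ := exists_iterate_symm_mem σ (h2 _ hc)
    obtain ⟨n₅, hn₅⟩ := exists_iterate_symm_mem σ (h2 _ hc')
    exact ⟨n₁ + n₂ + n₃ + n₄ + n₅, iterate_quotMap_mk_of_mem_Unr p σ S _ a b c
      (iterate_symm_mem_of_le σ h1 hn₁ (by omega)) (iterate_symm_mem_of_le σ h1 hn₂ (by omega))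
      (iterate_symm_mem_of_le σ h1 hn₃ (by omega)) (iterate_symm_mem_of_le σ h1 hn₄ (by omega))
      (iterate_symm_mem_of_le σ h1 hn₅ (by omega))⟩
  | zero => exact ⟨0, (Unr p K S).zero_mem⟩
  | add x y _ _ hx hy =>
    obtain ⟨m, hm⟩ := hx
    obtain ⟨n, hn⟩ := hy
    refine ⟨m + n, ?_⟩
    rw [iterate_map_add]
    exact (Unr p K S).add_mem (iterate_quotMap_mem_Unr_of_le p σ h1 hm (Nat.le_add_right m n))
      (iterate_quotMap_mem_Unr_of_le p σ h1 hn (Nat.le_add_left n m))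
  | neg x _ hx =>
    obtain ⟨m, hm⟩ := hx
    exact ⟨m, by rw [iterate_map_neg]; exact (Unr p K S).neg_mem hm⟩

/-! ## The stub -/

/-- **Transport of non-integrality down a periodic tower** (registered stub `stub_periodicTransport`
of the line `birth`): if `(σ, O, S, α)` is a periodic tower and `α ∉ Unr S`, then `α ∉ Unr O`.
[folklore] -/
theorem stub_periodicTransport (p : ℕ) (K : Type) [Field K] (σ : K ≃+* K) (O : ValuationSubring K) (S : Subring K) (α : G K ⧸ N p K) (hT : PeriodicTower p K σ O S α) (hS : α ∉ Unr p K S) : α ∉ Unr p K O.toSubring := by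
  obtain ⟨h1, h2, g, hg, hσg⟩ := hT
  intro hα
  apply hS
  -- `α` is fixed by `Φ_{σ⁻¹}` (apply `Φ_{σ⁻¹}` to `Φ_σ α = α`, which is (iii) on the lift `g`)
  have hfix : QuotientAddGroup.map (N p K) (N p K) (FreeAbelianGroup.map (tripleMap σ.symm))
      (N_le_comap p σ.symm) α = α := by
    conv_lhs => rw [← hσg, QuotientAddGroup.map_mk, map_symm_map_apply, hg]
  -- some power of `Φ_{σ⁻¹}` sends `α ∈ Unr O` into `Unr S`; that power fixes `α`
  obtain ⟨n, hn⟩ := exists_iterate_quotMap_mem_Unr p σ O S h1 h2 hα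
  rwa [Function.iterate_fixed hfix n] at hn

end Summit.ResolutionOfSingularities.ResolutionOfSingularities.Theorems.WildSymbol.Birth

end
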